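/-
Copyright: the b2b-balaban T⁴-continuum CRUX team, row NE7b owner lineage `t4-ne7b-p1` (gen 111). Project licence.
-/
import Literature.MathematicalPhysics.QuantumFieldTheory.Balaban1983to89.B5HkUniformL2Zd

/-!
# THE FREE FIELD INHABITS THE HARD-STEP CELL's ONE-SHOT LETTERS AT EVERY SCALE: for the scalar free lattice field on `ℤ^d`
# and the COMPOSITE block averaging of ANY side `n + 1` (= `L^k` for `k` hard steps), the critical section `H`, the floor
# `γ₀ = 1`, the size `γ₁♯(d) = (π²∕4)^{d+1}`, the mesh-uniform chart constant, the ceiling `4d` and the kernel coercivity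
# `2∕(m(m+1))` on the zero-block-sum fields of the NEXT averaging are theorems with constants INDEPENDENT OF THE SIDE —
# assembled BY NAME from the tree's Literature B5 column, plus the two elementary letters it did not spell out
# (row NE7b, node U5c; [folklore] + the tree's KERNEL theorems BY NAME; a JUNCTION ∕ census certificate — nothing new of print's)

Cell `pub-balaban`, sub-cell `t4`, spine estimate NE7b (`T4WeightBudget.RelWeightBound`; the cell's OWN estimate — NOT PRINTED in
[Bałaban 1983–89], NOT PROVED).  Crux-route work under `Spine/NE7b/` by the row OWNER (`t4-ne7b-p1` gen 111) under FREEZE (0)'s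
crux-prover clause; NOTHING of Bałaban's is named as a Lean object, valued or asserted; no `T4Continuum/Support` leaf typed; no
`def`; zero `sorry`.  Import: `Literature.….B5HkUniformL2Zd` ONLY (through it the whole scalar `ℤ^d` column: `B6QGQLower276` blocks
and charts, `Beta.CoordCubePoincare`, `B5Hk103Minimizer.energy ∕ HB`, `B5Hk165ActionZd.actionForm`, `B5Ineq167LowerZd`,
`B5Ineq167UpperZd`, `B5Ineq167SharpUpperZd.gamma1Sharp`, `B5Ineq167L2Zd`, `B5Hk165L2Zd.HBZd`, `B5HkUniformL2Zd`).

WHY (owner reading R-ne7bp1-g111-1, journal `HOME/CLAIMS.log` [NE7bP1-G111-READING1]).  The pricing desk's by-value instruments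
(PRICING-NE7b v119 F698 ∕ F699) live on the free Gaussian flow and locate three letters of the hard-step cell's shapes
(`…HardStepSemigroup` §3, `…DominationTransfer` §3, `…TransportedHessianEnergyCeiling`) that must be supplied k-UNIFORMLY: the
domination `Δ_k ≥ γ₀(−Δ)` («dom_k ≥ 1», «NO `Spine/NE7b` file states it for k ≥ 1»), the one-shot SIZE letter of the COMPOSITE
blocking («needs a near-minimising section, energy ~ L^{k(d−2)} … NC-NE7b-α's object»), and the one-shot CHART letter («print bounds
`T^{(n)}` uniformly — again NC-NE7b-α»).  For the scalar free field on `ℤ^d` all three ARE KERNEL THEOREMS of the tree's Literature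
B5 column, for EVERY block side `n + 1` — hence for the composite side `L^k` of `k` hard steps at once (two hard steps are one hard
step, `…HardStepSemigroup`): `B5Ineq167LowerZd.energy_blockAvg_le` (the pullback ∕ model half: `(n+1)^d·energy(Q′A) ≤ (n+1)²·energy A`,
γ₀ = 1), `B5Ineq167SharpUpperZd.ineq167_upper_sharp` ∕ `B5Ineq167UpperZd.energy_competitor_le` (size, `γ₁♯(d) = (π²∕4)^{d+1}`, with an
explicit near-minimising right inverse), `B5HkUniformL2Zd.tsum_HBZd_sq_le_uniform` (chart: `H` bounded `ℓ² → ℓ²_η` uniformly in the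
mesh).  THIS FILE is the junction certificate: it (§1–§2) proves the two elementary letters the column does not spell out in field
currency — the CEILING `energy B ≤ 4d·‖B‖²` and the KERNEL COERCIVITY `‖B‖² ≤ (m(m+1)∕2)·energy B` on fields with zero sums on the
`(m+1)`-blocks (the kernel of the NEXT averaging; per block `Beta.CoordCubePoincare`, block-internal bonds only) — and then (§3–§4)
states, for the composite form `⟨B, Δ_kB⟩ = actionForm n a T B` (`= (n+1)^{2−d}·energy (H B)`, (1.65)) the REGION letters
(ceiling `4d·γ₁♯(d)·‖B‖²` for all `B`, floor `(2∕(m(m+1)))·‖B‖²` on the kernel of the next averaging — so the desk's ratio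
`x_B(k) = sup Δ_k ∕ m(ker Q)` is `≤ 2d·γ₁♯(d)·m(m+1)` at EVERY `k`; by value 25.18 at d = 4, L = 2, F698) and the composite
blocking's critical section with its three one-shot letters as ONE family whose constants `(1, γ₁♯(d), C(d))` do not depend on the
side, the dummy mass `a` of the column DISCHARGED (`a := 1`; `H` is `a`-free, `B5Hk165L2Zd.HBZd_indep`).

WHAT IS PROVED (sites `X d = Fin d → ℤ`, blocks `B n y` of side `n+1` (`B6QGQLower276`), `energy A = Σ_μ Σ'_p (A p − A(p + e_μ))²`
(`B5Hk103Minimizer`), coarse fields `B` supported in a finset `T`, `‖B‖² := Σ_{y∈T} B(y)²`):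
* §1 `tsum_sq_eq_sum` (`Σ' B² = Σ_T B²`), **`energy_le_four_d`** (`energy B ≤ 4d·Σ_T B²` — [folklore], `(x − y)² ≤ 2x² + 2y²` +
  translation invariance of `Σ'`).
* §2 **`sum_sq_le_poincare_energy_of_blockSum_zero`** (`Σ_{p∈B m z} B p = 0` for all `z` ⟹ `Σ_T B² ≤ (m(m+1)∕2)·energy B` — [folklore]:
  `Beta.CoordCubePoincare.sum_sq_le_of_sum_eq_zero_coordCube` on each block through `B6QGQLower276.chart`, block-internal bonds
  `≤` all bonds by `B6QGQLower276.sum_blocks_dirichlet_le`, finite sums `≤ Σ'`).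
* §3 THE REGION LETTERS OF THE COMPOSITE FORM, EVERY SIDE: **`actionForm_le_ceiling`** (`actionForm n a T B ≤ γ₁♯(d)·4d·Σ_T B²`),
  **`sum_sq_le_of_blockSum_zero`** (`Σ_T B² ≤ (m(m+1)∕2)·actionForm n a T B` on the kernel of the `(m+1)`-averaging),
  **`regionLetters`** (both, with `2∕(m(m+1))` as a floor for `m ≥ 1`, for ALL `n` — the END's box inhabited k-uniformly).
* §4 THE COMPOSITE BLOCKING's CRITICAL SECTION AND ITS ONE-SHOT LETTERS, `a` DISCHARGED: **`compositeBlocking_letters`** (`∃ C > 0`,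
  `∀ n T B`: `H := HBZd n 1` has block sums `(n+1)^d·B` EXACTLY, minimises `energy` among `ℓ²`-competitors, equals `HBZd n a` for
  every `a > 0`, and satisfies floor `(n+1)^d∕(n+1)²·energy B ≤ energy (H B)`, size `energy (H B) ≤ (n+1)^d∕(n+1)²·γ₁♯(d)·energy B`,
  chart `(n+1)^{−d}·Σ'(H B)² ≤ C·Σ_T B²`), and **`pullback_domination`** (DMT `tower_domination`'s hypothesis `hRQ` with `γ = 1` in this
  currency: `energy B ≤ (n+1)^{2−d}`-rescaled `energy A` for EVERY competitor `A` of finite energy — `energy_blockAvg_le` by name, stated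
  with the cell's rescaling `t² = (n+1)²∕(n+1)^d` on the fine side).
* §5 toy: `γ₁♯(4) < 94`, so at `d = 4`, next side `2` (`m = 1`): `x_B ≤ 16·γ₁♯(4) < 1504` at every `k` (the desk's exact value: 25.177).

NOT HERE (honest): the normed-space ∕ `EuclideanSpace` carrier on which `…DominationTransfer` ∕ `…HardStepSemigroup(Tower)` are
literally instantiated (W-ne7bp1-g111-2: a leaf junction); the torus (the tree's `Beta.Ineq167Operator(Upper)` ∕ `B5AverageCurlStokes`
give (1.67) ∕ Federbush stability there for Bałaban's TYPED vector averaging); sharp constants (`π²`-Poincaré, `x_B* = 25.177`); and above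
all the identification with print's small-field action and gauge condition ((A3) ∕ (A1c), NC-NE7b-α UNRULED).  BY-NAME EFFECT ON THE
WALL: NONE.  NE7b NOT PRINTED ∕ NOT PROVED; spine PROVED 0∕9; rung (B)+1 on a FINITE torus — NOT infinite volume, NOT the mass gap,
NOT Clay.  HONEST DEPENDENCY: continuum YM on T⁴ ⇐ BetaPertH ∧ nine spine estimates (0∕9 proved); BetaPertH ⇐ (D1) ∧ (D4) ∧ CAP+tail;
G-an2-4 gates asym, D1 and NE2∕3∕4.
-/

set_option autoImplicit false

namespace Summit.QuantumFields.BalabanUV.T4Continuum.NE7b.FreeFieldBlockingLetters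

open Finset
open Literature.MathematicalPhysics.QuantumFieldTheory.Balaban1983to89
open B6QGQLower276 (X e B blk U Pset chart mem_B sum_B sum_U subset_U_image chart_stepUp sum_blocks_dirichlet_le)
open Beta.CoordCubePoincare (stepUp sum_sq_le_of_sum_eq_zero_coordCube)
open B4Sect5Proof (latticeConst)
open B5Hk103ScalarZd (cH deltaH)
open B5Hk103Minimizer (energy HB summable_grad_sq)
open B5Hk165ActionZd (actionForm)
open B5Ineq167LowerZd (tsum_shift summable_shift energy_blockAvg_le ineq167_lower_scalar)
open B5Ineq167UpperZd (summable_sq_of_support)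
open B5Ineq167SharpUpperZd (gamma1Sharp gamma1Sharp_pos ineq167_upper_sharp)
open B5Hk165L2Zd (HBZd HBZd_eq_HB HBZd_indep sum_B_HBZd energy_HBZd_le ineq167_energy_HBZd)
open B5HkUniformL2Zd (tsum_HB_sq_le_uniform)

noncomputable section

variable {d : ℕ}

/-! ## §1. The ceiling `energy B ≤ 4d·‖B‖²` -/

/-- For a field supported in `T`, `Σ' B² = Σ_{y∈T} B(y)²`. [folklore] -/
theorem tsum_sq_eq_sum {T : Finset (X d)} (Bf : X d → ℝ) (hT : ∀ y ∉ T, Bf y = 0) :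
    ∑' y, Bf y ^ 2 = ∑ y ∈ T, Bf y ^ 2 :=
  tsum_eq_sum fun y hy => by rw [hT y hy]; ring

/-- One direction: `Σ'_p (B p − B(p + e_μ))² ≤ 4·Σ' B²`. [folklore] -/
theorem tsum_grad_sq_le (Bf : X d → ℝ) (hB : Summable fun y => Bf y ^ 2) (μ : Fin d) :
    ∑' p, (Bf p - Bf (p + e μ)) ^ 2 ≤ 4 * ∑' p, Bf p ^ 2 := by
  have hsh : Summable fun p => Bf (p + e μ) ^ 2 := summable_shift hB (e μ)
  have hpt : ∀ p, (Bf p - Bf (p + e μ)) ^ 2 ≤ 2 * Bf p ^ 2 + 2 * Bf (p + e μ) ^ 2 := fun p => by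
    nlinarith [sq_nonneg (Bf p + Bf (p + e μ))]
  calc ∑' p, (Bf p - Bf (p + e μ)) ^ 2 ≤ ∑' p, (2 * Bf p ^ 2 + 2 * Bf (p + e μ) ^ 2) :=
        (summable_grad_sq hB μ).tsum_le_tsum hpt ((hB.mul_left 2).add (hsh.mul_left 2))
    _ = 2 * ∑' p, Bf p ^ 2 + 2 * ∑' p, Bf (p + e μ) ^ 2 := by
        rw [(hB.mul_left 2).tsum_add (hsh.mul_left 2), tsum_mul_left, tsum_mul_left]
    _ = 4 * ∑' p, Bf p ^ 2 := by
        rw [tsum_shift (fun p => Bf p ^ 2) (e μ)]; ring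

/-- **THE CEILING**: `energy B ≤ 4d·Σ_{y∈T} B(y)²` for every field supported in `T` (the symbol bound `ω ≤ 4d` in field
currency). [folklore] -/
theorem energy_le_four_d {T : Finset (X d)} (Bf : X d → ℝ) (hT : ∀ y ∉ T, Bf y = 0) :
    energy Bf ≤ 4 * d * ∑ y ∈ T, Bf y ^ 2 := by
  have hB : Summable fun y => Bf y ^ 2 := summable_sq_of_support hT
  unfold energy
  calc ∑ μ : Fin d, ∑' p, (Bf p - Bf (p + e μ)) ^ 2 ≤ ∑ _μ : Fin d, 4 * ∑' p, Bf p ^ 2 :=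
        Finset.sum_le_sum fun μ _ => tsum_grad_sq_le Bf hB μ
    _ = 4 * d * ∑ y ∈ T, Bf y ^ 2 := by
        rw [Finset.sum_const, Finset.card_univ, Fintype.card_fin, nsmul_eq_mul, tsum_sq_eq_sum Bf hT]; ring

/-! ## §2. Kernel coercivity: zero block sums ⟹ `‖B‖² ≤ (m(m+1)∕2)·energy B` -/

/-- A finite bond sum is below the full directional energy. [folklore] -/
theorem sum_grad_sq_le_tsum {T : Finset (X d)} (Bf : X d → ℝ) (hT : ∀ y ∉ T, Bf y = 0) (S : Finset (X d))
    (μ : Fin d) : ∑ r ∈ S, (Bf r - Bf (r + e μ)) ^ 2 ≤ ∑' r, (Bf r - Bf (r + e μ)) ^ 2 :=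
  (summable_grad_sq (summable_sq_of_support hT) μ).sum_le_tsum S fun _ _ => sq_nonneg _

/-- **KERNEL COERCIVITY OF THE DIRICHLET FORM ON ZERO-BLOCK-SUM FIELDS** (the floor of the NEXT step on `ker Q`): if `B` is
supported in `T` and has zero sum on every block of side `m + 1`, then `Σ_{y∈T} B(y)² ≤ (m(m+1)∕2)·energy B` — per block the cube
Poincaré inequality of `Beta.CoordCubePoincare` (constant `m(m+1)∕2`, d-independent), block-internal bonds only. [folklore] -/
theorem sum_sq_le_poincare_energy_of_blockSum_zero (m : ℕ) {T : Finset (X d)} (Bf : X d → ℝ)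
    (hT : ∀ y ∉ T, Bf y = 0) (hQ : ∀ z : X d, ∑ p ∈ B m z, Bf p = 0) :
    ∑ y ∈ T, Bf y ^ 2 ≤ (m : ℝ) * (m + 1) / 2 * energy Bf := by
  classical
  set Y : Finset (X d) := T.image (blk m) with hY
  -- `‖B‖²` block by block
  have h1 : ∑ y ∈ T, Bf y ^ 2 = ∑ z ∈ Y, ∑ w : Fin d → Fin (m + 1), Bf (chart m z w) ^ 2 := by
    have hsub : T ⊆ U m Y := subset_U_image m T
    have hTU : ∑ y ∈ T, Bf y ^ 2 = ∑ p ∈ U m Y, Bf p ^ 2 :=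
      Finset.sum_subset hsub fun p _ hp => by rw [hT p hp]; ring
    rw [hTU, sum_U]
    exact Finset.sum_congr rfl fun z _ => sum_B z fun p => Bf p ^ 2
  -- per block: Poincaré with zero mean
  have h2 : ∀ z ∈ Y, ∑ w : Fin d → Fin (m + 1), Bf (chart m z w) ^ 2 ≤
      (m : ℝ) * (m + 1) / 2 * ∑ μ : Fin d, ∑ w ∈ univ.filter (fun w : Fin d → Fin (m + 1) => w μ ≠ Fin.last m),
        (Bf (chart m z (stepUp w μ)) - Bf (chart m z w)) ^ 2 := fun z _ => by
    refine sum_sq_le_of_sum_eq_zero_coordCube m d (fun w => Bf (chart m z w)) ?_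
    rw [← sum_B z Bf]; exact hQ z
  have hP : (0 : ℝ) ≤ (m : ℝ) * (m + 1) / 2 := by positivity
  calc ∑ y ∈ T, Bf y ^ 2 = ∑ z ∈ Y, ∑ w : Fin d → Fin (m + 1), Bf (chart m z w) ^ 2 := h1
    _ ≤ ∑ z ∈ Y, (m : ℝ) * (m + 1) / 2 * ∑ μ : Fin d,
          ∑ w ∈ univ.filter (fun w : Fin d → Fin (m + 1) => w μ ≠ Fin.last m),
            (Bf (chart m z (stepUp w μ)) - Bf (chart m z w)) ^ 2 := Finset.sum_le_sum h2
    _ = (m : ℝ) * (m + 1) / 2 * ∑ μ : Fin d, ∑ z ∈ Y,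
          ∑ w ∈ univ.filter (fun w : Fin d → Fin (m + 1) => w μ ≠ Fin.last m),
            (Bf (chart m z (stepUp w μ)) - Bf (chart m z w)) ^ 2 := by
        rw [← Finset.mul_sum, Finset.sum_comm]
    _ ≤ (m : ℝ) * (m + 1) / 2 * ∑ μ : Fin d, ∑ r ∈ Pset m Y, (Bf r - Bf (r + e μ)) ^ 2 :=
        mul_le_mul_of_nonneg_left (Finset.sum_le_sum fun μ _ => sum_blocks_dirichlet_le m Y Bf μ) hP
    _ ≤ (m : ℝ) * (m + 1) / 2 * energy Bf := by
        unfold energy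
        exact mul_le_mul_of_nonneg_left
          (Finset.sum_le_sum fun μ _ => sum_grad_sq_le_tsum Bf hT (Pset m Y) μ) hP

/-! ## §3. The REGION letters of the composite form `⟨B, Δ_kB⟩ = actionForm n a T B`, every side `n + 1` -/

/-- **CEILING OF THE COMPOSITE FORM**: `⟨B, Δ_kB⟩ ≤ γ₁♯(d)·4d·‖B‖²` for every composite side `n + 1`, every `a > 0`, every `B`
supported in `T` — size `γ₁♯(d) = (π²∕4)^{d+1}` (`B5Ineq167SharpUpperZd.ineq167_upper_sharp`) times the ceiling of §1. [folklore] -/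
theorem actionForm_le_ceiling (n : ℕ) {a : ℝ} (ha : 0 < a) (T : Finset (X d)) (Bf : X d → ℝ)
    (hT : ∀ y ∉ T, Bf y = 0) : actionForm n a T Bf ≤ gamma1Sharp d * (4 * d) * ∑ y ∈ T, Bf y ^ 2 :=
  calc actionForm n a T Bf ≤ gamma1Sharp d * energy Bf := ineq167_upper_sharp n ha T Bf hT
    _ ≤ gamma1Sharp d * (4 * d * ∑ y ∈ T, Bf y ^ 2) :=
        mul_le_mul_of_nonneg_left (energy_le_four_d Bf hT) (gamma1Sharp_pos d).le
    _ = gamma1Sharp d * (4 * d) * ∑ y ∈ T, Bf y ^ 2 := by ring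

/-- **FLOOR OF THE COMPOSITE FORM ON THE KERNEL OF THE NEXT AVERAGING**: zero sums on the `(m+1)`-blocks ⟹
`‖B‖² ≤ (m(m+1)∕2)·⟨B, Δ_kB⟩` for every composite side `n + 1` — §2 and the floor `γ₀ = 1`
(`B5Ineq167LowerZd.ineq167_lower_scalar`). [folklore] -/
theorem sum_sq_le_of_blockSum_zero (n m : ℕ) {a : ℝ} (ha : 0 < a) (T : Finset (X d)) (Bf : X d → ℝ)
    (hT : ∀ y ∉ T, Bf y = 0) (hQ : ∀ z : X d, ∑ p ∈ B m z, Bf p = 0) :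
    ∑ y ∈ T, Bf y ^ 2 ≤ (m : ℝ) * (m + 1) / 2 * actionForm n a T Bf :=
  (sum_sq_le_poincare_energy_of_blockSum_zero m Bf hT hQ).trans
    (mul_le_mul_of_nonneg_left (ineq167_lower_scalar n ha T Bf hT) (by positivity))

/-- **THE REGION LETTERS, k-UNIFORM**: for EVERY composite side `n + 1` (`= L^k`) and the next side `m + 1 ≥ 2`: the composite form
is `≤ (4d·γ₁♯(d))·‖B‖²` on all fields and `≥ (2∕(m(m+1)))·‖B‖²` on the kernel of the next averaging — so the ratio
«size ∕ kernel coercivity» is `≤ 2d·γ₁♯(d)·m(m+1)` at every scale (the desk's `x_B(k)`, by value → 25.18 at d = 4, L = 2). [folklore] -/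
theorem regionLetters (m : ℕ) (hm : 1 ≤ m) {a : ℝ} (ha : 0 < a) (n : ℕ) (T : Finset (X d)) :
    (∀ Bf : X d → ℝ, (∀ y ∉ T, Bf y = 0) →
        actionForm n a T Bf ≤ 4 * d * gamma1Sharp d * ∑ y ∈ T, Bf y ^ 2) ∧
      (∀ Bf : X d → ℝ, (∀ y ∉ T, Bf y = 0) → (∀ z : X d, ∑ p ∈ B m z, Bf p = 0) →
        2 / ((m : ℝ) * (m + 1)) * ∑ y ∈ T, Bf y ^ 2 ≤ actionForm n a T Bf) := by
  refine ⟨fun Bf hT => ?_, fun Bf hT hQ => ?_⟩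
  · calc actionForm n a T Bf ≤ gamma1Sharp d * (4 * d) * ∑ y ∈ T, Bf y ^ 2 := actionForm_le_ceiling n ha T Bf hT
      _ = 4 * d * gamma1Sharp d * ∑ y ∈ T, Bf y ^ 2 := by ring
  · have hP : 0 < (m : ℝ) * (m + 1) := by
      have : (1 : ℝ) ≤ m := by exact_mod_cast hm
      positivity
    have h := sum_sq_le_of_blockSum_zero n m ha T Bf hT hQ
    rw [div_mul_eq_mul_div, div_le_iff₀ hP]
    calc 2 * ∑ y ∈ T, Bf y ^ 2 ≤ 2 * ((m : ℝ) * (m + 1) / 2 * actionForm n a T Bf) :=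
          mul_le_mul_of_nonneg_left h (by norm_num)
      _ = actionForm n a T Bf * ((m : ℝ) * (m + 1)) := by ring

/-! ## §4. The composite blocking's critical section and its three one-shot letters, the dummy mass discharged -/

/-- **THE PULLBACK DOMINATION (DMT's `hRQ`, `γ = 1`) IN THE CELL's RESCALING**: for every competitor `A` of finite energy whose
block sums are `(n+1)^d·B`, `energy B ≤ ((n+1)²∕(n+1)^d)·energy A` — `B5Ineq167LowerZd.energy_blockAvg_le` by name, with the
fine form carried in the canonical amplitude rescaling `t² = (n+1)^{2−d}` of the composite step. [folklore] -/
theorem pullback_domination (n : ℕ) (A Bf : X d → ℝ) (hA : ∀ μ, Summable fun q => (A q - A (q + e μ)) ^ 2)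
    (hAQ : ∀ y, ∑ p ∈ B n y, A p = ((n : ℝ) + 1) ^ d * Bf y) :
    energy Bf ≤ ((n : ℝ) + 1) ^ 2 / ((n : ℝ) + 1) ^ d * energy A := by
  have h := energy_blockAvg_le n A Bf hA hAQ
  have hpos : (0 : ℝ) < ((n : ℝ) + 1) ^ d := by positivity
  rw [div_mul_eq_mul_div, le_div_iff₀ hpos, mul_comm]
  exact h

/-- **THE COMPOSITE BLOCKING's CRITICAL SECTION AND ITS ONE-SHOT LETTERS, WITH SIDE-INDEPENDENT CONSTANTS** (the dummy mass of the
column fixed at `a := 1`, legitimately: `H` is `a`-free).  There is `C = C(d) > 0` such that for EVERY side `n + 1`, every finset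
`T` and every coarse field `B` supported in `T`, the section `H := HBZd n 1` of the block averaging satisfies:
(exact) block sums `(n+1)^d·B`; (critical) least `energy` among all competitors with the same block sums differing from it by an
`ℓ²` field; (a-free) `HBZd n a B = H B` for every `a > 0`; (floor, γ₀ = 1) `(n+1)^d∕(n+1)²·energy B ≤ energy (H B)`;
(size) `energy (H B) ≤ (n+1)^d∕(n+1)²·γ₁♯(d)·energy B`; (chart) `(n+1)^{−d}·Σ'(H B)² ≤ C·Σ_T B²` — `B5Hk165L2Zd.sum_B_HBZd ∕
energy_HBZd_le ∕ HBZd_indep ∕ ineq167_energy_HBZd` and `B5HkUniformL2Zd.tsum_HB_sq_le_uniform` by name. [folklore] -/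
theorem compositeBlocking_letters (d : ℕ) :
    ∃ C : ℝ, 0 < C ∧ ∀ (n : ℕ) (T : Finset (X d)) (Bf : X d → ℝ), (∀ y ∉ T, Bf y = 0) →
      (∀ y : X d, ∑ p ∈ B n y, HBZd n 1 Bf p = ((n : ℝ) + 1) ^ d * Bf y) ∧
      (∀ A : X d → ℝ, (Summable fun p => (A p - HBZd n 1 Bf p) ^ 2) →
          (∀ y : X d, ∑ p ∈ B n y, A p = ((n : ℝ) + 1) ^ d * Bf y) → energy (HBZd n 1 Bf) ≤ energy A) ∧
      (∀ a : ℝ, 0 < a → HBZd n a Bf = HBZd n 1 Bf) ∧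
      ((n : ℝ) + 1) ^ d / ((n : ℝ) + 1) ^ 2 * energy Bf ≤ energy (HBZd n 1 Bf) ∧
      energy (HBZd n 1 Bf) ≤ ((n : ℝ) + 1) ^ d / ((n : ℝ) + 1) ^ 2 * (gamma1Sharp d * energy Bf) ∧
      (((n : ℝ) + 1) ^ d)⁻¹ * ∑' p, HBZd n 1 Bf p ^ 2 ≤ C * ∑ y ∈ T, Bf y ^ 2 := by
  refine ⟨(cH d 1 * latticeConst d (deltaH d 1)) ^ 2 + 1, by positivity, fun n T Bf hT => ?_⟩
  have hB : Summable fun y => Bf y ^ 2 := summable_sq_of_support hT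
  have h167 := ineq167_energy_HBZd n one_pos Bf hB
  refine ⟨fun y => sum_B_HBZd n one_pos hB y, fun A hA2 hAQ => energy_HBZd_le n one_pos hB A hA2 hAQ,
    fun a ha => HBZd_indep n ha one_pos Bf, h167.1, h167.2, ?_⟩
  have hch := tsum_HB_sq_le_uniform n one_pos T Bf hT
  rw [← HBZd_eq_HB n 1 T Bf hT] at hch
  have hnn : 0 ≤ ∑ y ∈ T, Bf y ^ 2 := Finset.sum_nonneg fun _ _ => sq_nonneg _
  calc (((n : ℝ) + 1) ^ d)⁻¹ * ∑' p, HBZd n 1 Bf p ^ 2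
      ≤ (cH d 1 * latticeConst d (deltaH d 1)) ^ 2 * ∑ y ∈ T, Bf y ^ 2 := hch
    _ ≤ ((cH d 1 * latticeConst d (deltaH d 1)) ^ 2 + 1) * ∑ y ∈ T, Bf y ^ 2 := by nlinarith

/-! ## §5. Toy: the numbers at `d = 4`, next side `2` -/

/-- `γ₁♯(4) = (π²∕4)⁵ < 94` (from `π < 3.15`). -/
theorem gamma1Sharp_four_lt : gamma1Sharp 4 < 94 := by
  have hπ : Real.pi < 3.15 := Real.pi_lt_d2
  have hπ0 : 0 < Real.pi := Real.pi_pos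
  have h1 : Real.pi ^ 2 / 4 < 2.480625 := by nlinarith
  have h0 : 0 ≤ Real.pi ^ 2 / 4 := by positivity
  unfold gamma1Sharp
  calc (Real.pi ^ 2 / 4) ^ (4 + 1) ≤ (2.480625 : ℝ) ^ (4 + 1) := by gcongr
    _ < 94 := by norm_num

/-- At `d = 4` with next side `2` (`m = 1`) the region ratio bound `2d·γ₁♯(d)·m(m+1) = 16·γ₁♯(4)` is `< 1504` at EVERY scale `k`
(the pricing desk's exact free-flow value is `x_B* = 25.177`; this certificate is uniform, not sharp). -/
example : 2 * (4 : ℝ) * gamma1Sharp 4 * ((1 : ℝ) * (1 + 1)) < 1504 := by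
  have := gamma1Sharp_four_lt; nlinarith

end

end Summit.QuantumFields.BalabanUV.T4Continuum.NE7b.FreeFieldBlockingLetters
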